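import Summits.CriticalPhenomena.Ising3DConformalLimit.Theorems.SynchronousCouplingRotationJoiningL2Gluing

/-!
# Route `SynchronousCoupling`, crux `RotationJoining` (stmt-CriticalPhenomena-18763), line `SketchIdeator2`:
`stub_rateBootstrap` — the rate is inherited from the dilation joinings

`RateBootstrap : DilationJoiningsAxis3 → DilationJoiningsTilted → QualitativeRotationJoining → RotationJoining`
(card `rate-from-dilations-splitting`). Proof: for fixed `(n, m)` glue the chain of couplings of `μ` with itself
`tilt⁽ⁿ⁾ ~ tilt⁽³ⁿ⁾ ~ … ~ tilt⁽ᴺ⁾ ~ axis⁽ᴺ⁾ ~ … ~ axis⁽³ⁿ⁾ ~ axis⁽ⁿ⁾`, `N = 3ʲ n ≥ N(ε)`, `ε = n^(-θ)`,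
`θ = min θ_axis θ_tilt`, with the `L²` gluing chain `l2_glue_chain` (file `…RotationJoiningL2Gluing`): the per-block
defects add (Minkowski in `L²` of the glued space, all blocks of the window at once since each coupling serves the
whole window), and `Σ_k (3ᵏ n)^(-θ/2) ≤ n^(-θ/2) / (1 - 3^(-θ/2))`. Constant: `C = ((√|C_tilt| + √|C_axis|)/(1-3^(-θ/2)) + 1)²`.
-/

noncomputable section

namespace Summit.CriticalPhenomena.Ising3DConformalLimit.Cruxes.RotationJoining.RateSplitting

open MeasureTheory ProbabilityTheory Literature.Probability.LatticeModels

/-! ### Observables: measurability and bounds -/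

/-- `blockSum S` is measurable. -/
theorem measurable_blockSum (S : Finset (Site 3)) : Measurable (blockSum S) := by
  unfold blockSum
  exact Finset.measurable_sum S fun x _ => measurable_spinAt x

/-- `|blockSum S σ| ≤ #S`. -/
theorem abs_blockSum_le (S : Finset (Site 3)) (σ : SpinConfig (Site 3)) : |blockSum S σ| ≤ S.card := by
  unfold blockSum
  calc |∑ x ∈ S, spinAt x σ| ≤ ∑ x ∈ S, |spinAt x σ| := Finset.abs_sum_le_sum_abs _ _
    _ = S.card := by simp [abs_spinAt]

/-- A normalised block `σ ↦ c · blockSum S σ` is measurable. -/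
theorem measurable_const_mul_blockSum (c : ℝ) (S : Finset (Site 3)) :
    Measurable fun σ : SpinConfig (Site 3) => c * blockSum S σ :=
  (measurable_blockSum S).const_mul c

/-- A normalised block `σ ↦ c · blockSum S σ` is bounded. -/
theorem bounded_const_mul_blockSum (c : ℝ) (S : Finset (Site 3)) :
    ∃ B : ℝ, ∀ σ : SpinConfig (Site 3), |c * blockSum S σ| ≤ B :=
  ⟨|c| * S.card, fun σ => by rw [abs_mul]; gcongr; exact abs_blockSum_le S σ⟩

/-! ### The crux in the line's vocabulary -/

/-- The `u = 0` tilted cell is the crux's normalising cell (`3n·0 ≤ · < 3n(0+1)` is `0 ≤ · < 3n`). -/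
theorem tiltCell_zero (n m : ℕ) :
    tiltCell n m 0 =
      (Fintype.piFinset fun _ : Fin 3 =>
          Finset.Icc (-(2 * (n : ℤ) * ((m : ℤ) + 1))) (2 * (n : ℤ) * ((m : ℤ) + 1))).filter
        fun x => ∀ i, 0 ≤ A3.mulVec x i ∧ A3.mulVec x i < 3 * (n : ℤ) := by
  unfold tiltCell
  ext x
  simp

/-- The `u = 0` axis cell is `[0, n)³`. -/
theorem axisCell_zero' (n : ℕ) : axisCell n 0 = Fintype.piFinset fun _ : Fin 3 => Finset.Ico (0 : ℤ) (n : ℤ) := by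
  unfold axisCell
  simp

/-- **Vocabulary form of the crux.** A window-uniform power-rate rotation joining stated with `normTilt`, `tiltCell`,
`normAxis`, `axisCell` is literally the route decl `RotationJoining`. -/
theorem rotationJoining_of_vocab
    (h : ∀ μ ∈ isingGibbsMeasures 3 (criticalBeta 3) 0, IsTranslationInvariantMeasure μ →
      ∃ C θ : ℝ, 0 < θ ∧ ∀ n m : ℕ, 1 ≤ n →
        ∃ π : Measure (SpinConfig (Site 3) × SpinConfig (Site 3)), π.fst = μ ∧ π.snd = μ ∧
          ∀ u : Fin 3 → ℤ, (∀ i, |u i| ≤ m) →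
            ∫ q, (normTilt μ n m * blockSum (tiltCell n m u) q.1
                    - normAxis μ n * blockSum (axisCell n u) q.2) ^ 2 ∂π ≤ C * (n : ℝ) ^ (-θ)) :
    Summit.CriticalPhenomena.Ising3DConformalLimit.Theses.SynchronousCoupling.RotationJoining := by
  intro μ hμ hTI
  obtain ⟨C, θ, hθ, h⟩ := h μ hμ hTI
  refine ⟨C, θ, hθ, fun n m hn => ?_⟩
  obtain ⟨π, h1, h2, h3⟩ := h n m hn
  refine ⟨π, h1, h2, fun u hu => ?_⟩
  have key := h3 u hu
  rw [normTilt, normAxis, tiltCell_zero, axisCell_zero'] at key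
  simpa only [blockSum, tiltCell, axisCell, A3] using key


/-! ### Small analytic tools -/

/-- `√(x^(-θ)) = x^(-θ/2)` for `x ≥ 0`. -/
theorem sqrt_rpow_neg {x : ℝ} (hx : 0 ≤ x) (θ : ℝ) : Real.sqrt (x ^ (-θ)) = x ^ (-(θ / 2)) := by
  rw [Real.sqrt_eq_rpow, ← Real.rpow_mul hx]
  congr 1
  ring

/-- `(3ᵏ n)^(-θ/2) = n^(-θ/2) · (3^(-θ/2))ᵏ`. -/
theorem scale_rpow (n k : ℕ) (θ : ℝ) :
    ((3 ^ k * n : ℕ) : ℝ) ^ (-(θ / 2)) = (n : ℝ) ^ (-(θ / 2)) * ((3 : ℝ) ^ (-(θ / 2))) ^ k := by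
  push_cast
  rw [Real.mul_rpow (by positivity) (by positivity), mul_comm, ← Real.rpow_pow_comm (by norm_num) _ k]

/-- Swapping the two copies of a coupling swaps the roles of the two observables in the `L²` defect. -/
theorem integral_sq_sub_map_swap {Ω : Type*} [MeasurableSpace Ω] (π : Measure (Ω × Ω)) {F G : Ω → ℝ}
    (hF : Measurable F) (hG : Measurable G) :
    ∫ q, (F q.1 - G q.2) ^ 2 ∂(π.map Prod.swap) = ∫ q, (G q.1 - F q.2) ^ 2 ∂π := by
  rw [integral_map measurable_swap.aemeasurable]
  · refine integral_congr_ae (ae_of_all _ fun q => ?_)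
    simp only [Prod.fst_swap, Prod.snd_swap]
    ring
  · exact ((hF.comp measurable_fst).sub (hG.comp measurable_snd)).pow_const 2 |>.aestronglyMeasurable

/-! ### The rate bootstrap -/

/-- **Registered stub `stub_rateBootstrap`** of the line `SketchIdeator2`: dilation joinings for axis cells and for
tilted cells plus a qualitative window-uniform rotation joining give the crux `RotationJoining` with the power rate
`θ = min θ_axis θ_tilt` (gluing along `n, 3n, …, 3ʲn` with `3ʲn ≥ N(n^(-θ))`, Minkowski in `L²`, geometric series). -/
theorem stub_rateBootstrap : Sig.stub_rateBootstrap := by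
  intro hAx hTi hQu
  refine rotationJoining_of_vocab fun μ hμ hTI => ?_
  haveI : IsProbabilityMeasure μ := IsGibbsMeasure.isProbabilityMeasure hμ
  obtain ⟨CA, θA, hθA, hA⟩ := hAx μ hμ hTI
  obtain ⟨CT, θT, hθT, hT⟩ := hTi μ hμ hTI
  have hQ := hQu μ hμ hTI
  choose πA hπA1 hπA2 hπA3 using hA
  choose πT hπT1 hπT2 hπT3 using hT
  -- the exponent and the constant
  set θ : ℝ := min θA θT with hθdef
  have hθ : 0 < θ := lt_min hθA hθT
  have hθA' : θ ≤ θA := min_le_left _ _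
  have hθT' : θ ≤ θT := min_le_right _ _
  set r : ℝ := (3 : ℝ) ^ (-(θ / 2)) with hrdef
  have hr0 : 0 < r := Real.rpow_pos_of_pos (by norm_num) _
  have hr1 : r < 1 := Real.rpow_lt_one_of_one_lt_of_neg (by norm_num) (by linarith)
  have h1r : 0 < 1 - r := by linarith
  set S : ℝ := (1 - r)⁻¹ with hSdef
  have hS0 : 0 < S := inv_pos.mpr h1r
  set K : ℝ := (Real.sqrt |CT| + Real.sqrt |CA|) * S + 1 with hKdef
  have hK0 : 0 ≤ K := by positivity
  refine ⟨K ^ 2, θ, hθ, fun n m hn => ?_⟩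
  -- the scales `s k = 3ᵏ n`
  have hn0 : (0 : ℝ) < n := by exact_mod_cast hn
  set s : ℕ → ℕ := fun k => 3 ^ k * n with hsdef
  have hs1 : ∀ k, 1 ≤ s k := fun k => one_le_mul (Nat.one_le_pow _ _ (by norm_num)) hn
  have hs3 : ∀ k, 3 * s k = s (k + 1) := fun k => by simp only [hsdef, pow_succ]; ring
  have hs0 : s 0 = n := by simp [hsdef]
  have hsR1 : ∀ k, (1 : ℝ) ≤ (s k : ℝ) := fun k => by exact_mod_cast hs1 k
  have hsR : ∀ k, ((s k : ℕ) : ℝ) ^ (-(θ / 2)) = (n : ℝ) ^ (-(θ / 2)) * r ^ k := fun k => scale_rpow n k θ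
  -- `ε = n^(-θ)` and the far scale `s j ≥ N(ε)`
  set ε : ℝ := (n : ℝ) ^ (-θ) with hεdef
  have hε : 0 < ε := Real.rpow_pos_of_pos hn0 _
  obtain ⟨N, hN⟩ := hQ ε hε
  have hNj : N ≤ s N := le_trans (Nat.lt_pow_self (by norm_num : 1 < 3)).le (Nat.le_mul_of_pos_right _ hn)
  set j : ℕ := N with hjdef
  obtain ⟨πQ, hπQ1, hπQ2, hπQ3⟩ := hN (s j) m hNj
  -- chain A (tilted cells along `s 0, …, s j`) and chain B (axis cells)
  obtain ⟨TA, hTA1, hTA2, hTA⟩ := l2_glue_chain μ (fun k => (πT (s k) m (hs1 k)).map Prod.swap)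
    (fun k => by rw [Measure.fst_map_swap, hπT2])
    (fun k => by rw [Measure.snd_map_swap, hπT1]) j
  obtain ⟨TB, hTB1, hTB2, hTB⟩ := l2_glue_chain μ (fun k => (πA (s k) m (hs1 k)).map Prod.swap)
    (fun k => by rw [Measure.fst_map_swap, hπA2])
    (fun k => by rw [Measure.snd_map_swap, hπA1]) j
  -- glue `TA ~ πQ ~ TB.swap`
  haveI : IsProbabilityMeasure TA := isProbabilityMeasure_of_fst_eq hTA1
  haveI : IsProbabilityMeasure πQ := isProbabilityMeasure_of_fst_eq hπQ1
  obtain ⟨T1, hT11, hT12, hT1⟩ := l2_glue_step TA πQ (by rw [hTA2, hπQ1])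
  haveI : IsProbabilityMeasure T1 := isProbabilityMeasure_of_fst_eq (hT11.trans hTA1)
  haveI : IsProbabilityMeasure (TB.map Prod.swap) :=
    isProbabilityMeasure_of_fst_eq (μ := μ) (by rw [Measure.fst_map_swap, hTB2])
  obtain ⟨T, hT1', hT2', hTfin⟩ :=
    l2_glue_step T1 (TB.map Prod.swap) (by rw [hT12, hπQ2, Measure.fst_map_swap, hTB2])
  refine ⟨T, by rw [hT1', hT11, hTA1], by rw [hT2', Measure.snd_map_swap, hTB1], fun u hu => ?_⟩
  -- the observables of block `u` along the scales
  set tl : ℕ → SpinConfig (Site 3) → ℝ :=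
    fun k σ => normTilt μ (s k) m * blockSum (tiltCell (s k) m u) σ with htl
  set ax : ℕ → SpinConfig (Site 3) → ℝ :=
    fun k σ => normAxis μ (s k) * blockSum (axisCell (s k) u) σ with hax
  have mtl : ∀ k, Measurable (tl k) := fun k => measurable_const_mul_blockSum _ _
  have maxs : ∀ k, Measurable (ax k) := fun k => measurable_const_mul_blockSum _ _
  have btl : ∀ k, ∃ B, ∀ σ, |tl k σ| ≤ B := fun k => bounded_const_mul_blockSum _ _
  have bax : ∀ k, ∃ B, ∀ σ, |ax k σ| ≤ B := fun k => bounded_const_mul_blockSum _ _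
  -- generic step estimate: `LHS ≤ C x^(-θ') ⇒ √LHS ≤ √|C| · x^(-θ/2)` for `x = s k ≥ 1`, `θ ≤ θ'`
  have root : ∀ (I C θ' : ℝ) (k : ℕ), θ ≤ θ' → I ≤ C * ((s k : ℕ) : ℝ) ^ (-θ') →
      Real.sqrt I ≤ Real.sqrt |C| * ((n : ℝ) ^ (-(θ / 2)) * r ^ k) := by
    intro I C θ' k hθ' hI
    have h1 : I ≤ |C| * ((s k : ℕ) : ℝ) ^ (-θ) :=
      calc I ≤ C * ((s k : ℕ) : ℝ) ^ (-θ') := hI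
        _ ≤ |C| * ((s k : ℕ) : ℝ) ^ (-θ') :=
            mul_le_mul_of_nonneg_right (le_abs_self C) (Real.rpow_nonneg (by positivity) _)
        _ ≤ |C| * ((s k : ℕ) : ℝ) ^ (-θ) :=
            mul_le_mul_of_nonneg_left (Real.rpow_le_rpow_of_exponent_le (hsR1 k) (by linarith))
              (abs_nonneg C)
    calc Real.sqrt I ≤ Real.sqrt (|C| * ((s k : ℕ) : ℝ) ^ (-θ)) := Real.sqrt_le_sqrt h1
      _ = Real.sqrt |C| * ((n : ℝ) ^ (-(θ / 2)) * r ^ k) := by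
          rw [Real.sqrt_mul (abs_nonneg C), sqrt_rpow_neg (by positivity), hsR k]
  -- per-step bounds
  have stepT : ∀ k, Real.sqrt (∫ q, (tl k q.1 - tl (k + 1) q.2) ^ 2 ∂((πT (s k) m (hs1 k)).map Prod.swap)) ≤
      Real.sqrt |CT| * ((n : ℝ) ^ (-(θ / 2)) * r ^ k) := by
    intro k
    rw [integral_sq_sub_map_swap _ (mtl k) (mtl (k + 1))]
    have hb := hπT3 (s k) m (hs1 k) u hu
    rw [hs3 k] at hb
    refine root _ CT θT k hθT' ?_
    simpa only [htl] using hb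
  have stepA : ∀ k, Real.sqrt (∫ q, (ax k q.1 - ax (k + 1) q.2) ^ 2 ∂((πA (s k) m (hs1 k)).map Prod.swap)) ≤
      Real.sqrt |CA| * ((n : ℝ) ^ (-(θ / 2)) * r ^ k) := by
    intro k
    rw [integral_sq_sub_map_swap _ (maxs k) (maxs (k + 1))]
    have hb := hπA3 (s k) m (hs1 k) u hu
    rw [hs3 k] at hb
    refine root _ CA θA k hθA' ?_
    simpa only [hax] using hb
  have stepQ : Real.sqrt (∫ q, (tl j q.1 - ax j q.2) ^ 2 ∂πQ) ≤ (n : ℝ) ^ (-(θ / 2)) := by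
    have hb := hπQ3 u hu
    calc Real.sqrt (∫ q, (tl j q.1 - ax j q.2) ^ 2 ∂πQ) ≤ Real.sqrt ε := Real.sqrt_le_sqrt (by
            simpa only [htl, hax] using hb)
      _ = (n : ℝ) ^ (-(θ / 2)) := sqrt_rpow_neg hn0.le θ
  -- geometric series
  have geom : ∑ k ∈ Finset.range j, r ^ k ≤ S := by
    have hmul : (1 - r) * ∑ k ∈ Finset.range j, r ^ k ≤ (1 - r) * S := by
      rw [mul_neg_geom_sum, hSdef, mul_inv_cancel₀ h1r.ne']
      have := pow_nonneg hr0.le j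
      linarith
    exact le_of_mul_le_mul_left hmul h1r
  -- the two chains
  have dA : Real.sqrt (∫ q, (tl 0 q.1 - tl j q.2) ^ 2 ∂TA) ≤ Real.sqrt |CT| * (n : ℝ) ^ (-(θ / 2)) * S := by
    calc Real.sqrt (∫ q, (tl 0 q.1 - tl j q.2) ^ 2 ∂TA)
        ≤ ∑ k ∈ Finset.range j,
            Real.sqrt (∫ q, (tl k q.1 - tl (k + 1) q.2) ^ 2 ∂((πT (s k) m (hs1 k)).map Prod.swap)) :=
          hTA tl mtl btl
      _ ≤ ∑ k ∈ Finset.range j, Real.sqrt |CT| * ((n : ℝ) ^ (-(θ / 2)) * r ^ k) :=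
          Finset.sum_le_sum fun k _ => stepT k
      _ = Real.sqrt |CT| * (n : ℝ) ^ (-(θ / 2)) * ∑ k ∈ Finset.range j, r ^ k := by
          rw [← Finset.mul_sum, ← Finset.mul_sum, ← mul_assoc]
      _ ≤ Real.sqrt |CT| * (n : ℝ) ^ (-(θ / 2)) * S := by gcongr
  have dB : Real.sqrt (∫ q, (ax j q.1 - ax 0 q.2) ^ 2 ∂(TB.map Prod.swap)) ≤
      Real.sqrt |CA| * (n : ℝ) ^ (-(θ / 2)) * S := by
    rw [integral_sq_sub_map_swap _ (maxs j) (maxs 0)]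
    calc Real.sqrt (∫ q, (ax 0 q.1 - ax j q.2) ^ 2 ∂TB)
        ≤ ∑ k ∈ Finset.range j,
            Real.sqrt (∫ q, (ax k q.1 - ax (k + 1) q.2) ^ 2 ∂((πA (s k) m (hs1 k)).map Prod.swap)) :=
          hTB ax maxs bax
      _ ≤ ∑ k ∈ Finset.range j, Real.sqrt |CA| * ((n : ℝ) ^ (-(θ / 2)) * r ^ k) :=
          Finset.sum_le_sum fun k _ => stepA k
      _ = Real.sqrt |CA| * (n : ℝ) ^ (-(θ / 2)) * ∑ k ∈ Finset.range j, r ^ k := by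
          rw [← Finset.mul_sum, ← Finset.mul_sum, ← mul_assoc]
      _ ≤ Real.sqrt |CA| * (n : ℝ) ^ (-(θ / 2)) * S := by gcongr
  -- Minkowski along `tl 0 ~ tl j ~ ax j ~ ax 0`
  have total : Real.sqrt (∫ q, (tl 0 q.1 - ax 0 q.2) ^ 2 ∂T) ≤ K * (n : ℝ) ^ (-(θ / 2)) :=
    calc Real.sqrt (∫ q, (tl 0 q.1 - ax 0 q.2) ^ 2 ∂T)
        ≤ Real.sqrt (∫ q, (tl 0 q.1 - ax j q.2) ^ 2 ∂T1) +
            Real.sqrt (∫ q, (ax j q.1 - ax 0 q.2) ^ 2 ∂(TB.map Prod.swap)) :=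
          hTfin (tl 0) (ax j) (ax 0) (mtl 0) (maxs j) (maxs 0) (btl 0) (bax j) (bax 0)
      _ ≤ (Real.sqrt (∫ q, (tl 0 q.1 - tl j q.2) ^ 2 ∂TA) + Real.sqrt (∫ q, (tl j q.1 - ax j q.2) ^ 2 ∂πQ)) +
            Real.sqrt (∫ q, (ax j q.1 - ax 0 q.2) ^ 2 ∂(TB.map Prod.swap)) := by
          gcongr
          exact hT1 (tl 0) (tl j) (ax j) (mtl 0) (mtl j) (maxs j) (btl 0) (btl j) (bax j)
      _ ≤ (Real.sqrt |CT| * (n : ℝ) ^ (-(θ / 2)) * S + (n : ℝ) ^ (-(θ / 2))) +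
            Real.sqrt |CA| * (n : ℝ) ^ (-(θ / 2)) * S := by
          gcongr
      _ = K * (n : ℝ) ^ (-(θ / 2)) := by rw [hKdef]; ring
  -- square and return to scale `n = s 0`
  have hI0 : 0 ≤ ∫ q, (tl 0 q.1 - ax 0 q.2) ^ 2 ∂T := integral_nonneg fun q => sq_nonneg _
  have hsq : ∫ q, (tl 0 q.1 - ax 0 q.2) ^ 2 ∂T ≤ K ^ 2 * (n : ℝ) ^ (-θ) := by
    have h1 : ∫ q, (tl 0 q.1 - ax 0 q.2) ^ 2 ∂T ≤ (K * (n : ℝ) ^ (-(θ / 2))) ^ 2 := by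
      rw [← Real.sq_sqrt hI0]
      exact pow_le_pow_left₀ (Real.sqrt_nonneg _) total 2
    have h2 : (K * (n : ℝ) ^ (-(θ / 2))) ^ 2 = K ^ 2 * (n : ℝ) ^ (-θ) := by
      rw [mul_pow, ← Real.rpow_natCast ((n : ℝ) ^ (-(θ / 2))) 2, ← Real.rpow_mul hn0.le]
      congr 1
      norm_num
    rw [← h2]
    exact h1
  have hfun : (fun q : SpinConfig (Site 3) × SpinConfig (Site 3) => (tl 0 q.1 - ax 0 q.2) ^ 2) =
      fun q => (normTilt μ n m * blockSum (tiltCell n m u) q.1 - normAxis μ n * blockSum (axisCell n u) q.2) ^ 2 := by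
    funext q
    simp only [htl, hax, hs0]
  rw [hfun] at hsq
  exact hsq

end Summit.CriticalPhenomena.Ising3DConformalLimit.Cruxes.RotationJoining.RateSplitting

end
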